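import Literature.Computability.Complexity.TruthTableClosure
import Literature.Computability.Complexity.NPClosureProofs
import Literature.Computability.Complexity.SharpPClosure
import Literature.Computability.Complexity.BranchingFn
import HarnessLib

/-!
# `NP` and `coNP` are closed under polynomially bounded quantifiers `∀ i < q(|x|)`, `∃ i < q(|x|)`

Trunk `CplxCore`, toolkit continuing `TruthTableClosure.lean` (which proves the closure of `P`
under the bounded quantifiers `ballLang q A = {x | ∀ i < q(|x|), ⟨x, 1ⁱ⟩ ∈ A}` and
`bexLang q A = {x | ∃ i < q(|x|), ⟨x, 1ⁱ⟩ ∈ A}`) and `NPClosureProofs.lean` (closure of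
`NP = ∃ᵖ·P` under polynomial-time preimages and under `∩`/`∪` with `P` languages).

* `bexLang_mem_NP` — `A ∈ NP ⇒ bexLang q A ∈ NP`: guess the index `i` together with the
  certificate of `⟨x, 1ⁱ⟩ ∈ A` (witness `⟨1ⁱ, w⟩`; the verifier re-normalises the first component
  to a unary numeral with `onesFn`, tests `i < q(|x|)` by `LenLt`, and runs the verifier of `A`).
* `ballLang_mem_NP` — `A ∈ NP ⇒ ballLang q A ∈ NP`: guess the LIST of certificates
  `body [w₀, …, w_{q(|x|)-1}]` (the `boolPair`-nested list code of `CookReducibilityTransitive.lean`)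
  and verify all of them in a polynomially bounded loop — the loop is `ballLang_mem_P` applied to
  the `P` language reading the `i`-th certificate off the list by the polynomial-time list access
  `elemFn` (`PRelSigmaPi.lean`); no machine is programmed (`onesFn_eq_replicate` of
  `SharpPClosure.lean` normalises the unary index).
* `ballLang_mem_coNP`, `bexLang_mem_coNP` — the dual statements (`(ballLang q A)ᶜ = bexLang q Aᶜ`).

These are the textbook facts "NP is closed under polynomially bounded existential AND universal
quantification (concatenate the certificates)" (Arora–Barak 2009, §2.1, Claim 2.4's discussion and
Exercise 2.10 (NP closed under ∪, ∩); the bounded-`∀` closure is the `k`-fold conjunction with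
`k = poly(|x|)` conjuncts, e.g. Papadimitriou 1994, Prop. 10.2's proof technique), used in the tree
for Aharonov–Regev 2005, Lemma A.1 ("a NO witness for `L` can be given by `n` NO witnesses for
`(Lᵢ, bᵢ)`").

## References

* S. Arora, B. Barak, *Computational Complexity: A Modern Approach*, CUP 2009, Def. 2.1, §2.1,
  Exercise 2.10, §1.3 (polynomial time is closed under polynomially bounded loops).
* C. H. Papadimitriou, *Computational Complexity*, Addison-Wesley 1994, §10.1.
* D. Aharonov, O. Regev, *Lattice problems in NP ∩ coNP*, J. ACM 52 (2005), Lemma A.1.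
-/

namespace Literature.Computability.Complexity

open _root_.Computability Polynomial OracleCompose PRelSigPi

namespace NPBounded

attribute [local simp] onesFn_eq_replicate

/-! ### `∃ i < q(|x|)` over `NP` -/

/-- The re-normalising map of the `bexLang` verifier: `⟨x, ⟨j, w⟩⟩ ↦ ⟨⟨x, 1^{|j|}⟩, w⟩`. [folklore] -/
noncomputable def bexG : List Bool → List Bool :=
  pairFn (pairFn fstP (onesFn ∘ fstP ∘ sndP)) (sndP ∘ sndP)

/-- `bexG ∈ FP`. [folklore] -/
theorem bexG_mem_FP : bexG ∈ FP :=
  pairFn_mem_FP (pairFn_mem_FP fstP_mem_FP (comp_mem_FP onesFn_mem_FP (comp_mem_FP fstP_mem_FP sndP_mem_FP)))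
    (comp_mem_FP sndP_mem_FP sndP_mem_FP)

/-- Value of `bexG` on a pair. [folklore] -/
@[simp] theorem bexG_boolPair (x y : List Bool) :
    bexG (boolPair x y) = boolPair (boolPair x (List.replicate (fstP y).length true)) (sndP y) := by
  simp [bexG]

/-- The strict index test of the `bexLang` verifier: `⟨x, ⟨j, w⟩⟩ ↦ ⟨x, j⟩`, to be tested in `LenLt q`.
[folklore] -/
noncomputable def bexI : List Bool → List Bool :=
  pairFn fstP (fstP ∘ sndP)

/-- `bexI ∈ FP`. [folklore] -/
theorem bexI_mem_FP : bexI ∈ FP :=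
  pairFn_mem_FP fstP_mem_FP (comp_mem_FP fstP_mem_FP sndP_mem_FP)

/-- Value of `bexI` on a pair. [folklore] -/
@[simp] theorem bexI_boolPair (x y : List Bool) : bexI (boolPair x y) = boolPair x (fstP y) := by
  simp [bexI]

/-- **`NP` is closed under polynomially bounded `∃`**: `bexLang q A ∈ NP` for `A ∈ NP` (guess the
index and the certificate). [Arora–Barak 2009, §2.1 and Exercise 2.10] [cite: AroraBarakCC2009, Def. 2.1] -/
theorem bexLang_mem_NP (q : Polynomial ℕ) {A : Language Bool} (hA : A ∈ Nondeterministic.NP) : bexLang q A ∈ Nondeterministic.NP := by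
  obtain ⟨R, hR, p, hp⟩ := hA
  refine ⟨bexI ⁻¹' LenLt q ⊓ bexG ⁻¹' (LenLe p ⊓ R),
    inter_mem_P (preimage_mem_P (LenLt_mem_P q) bexI_mem_FP)
      (preimage_mem_P (inter_mem_P (LenLe_mem_P p) hR) bexG_mem_FP),
    2 * q + 2 + p.comp (2 * X + 2 + q), fun x => ?_⟩
  have hmem : ∀ y : List Bool,
      boolPair x y ∈ (bexI ⁻¹' LenLt q ⊓ bexG ⁻¹' (LenLe p ⊓ R) : Language Bool) ↔
        (fstP y).length < q.eval x.length ∧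
          (sndP y).length ≤ p.eval (boolPair x (List.replicate (fstP y).length true)).length ∧
            boolPair (boolPair x (List.replicate (fstP y).length true)) (sndP y) ∈ R := fun y => by
    change (bexI (boolPair x y) ∈ LenLt q ∧ (bexG (boolPair x y) ∈ LenLe p ∧ bexG (boolPair x y) ∈ R)) ↔ _
    rw [bexI_boolPair, bexG_boolPair, boolPair_mem_LenLt, boolPair_mem_LenLe]
  rw [mem_bexLang]
  constructor
  · rintro ⟨i, hi, hiA⟩
    obtain ⟨w, hw, hwR⟩ := (hp _).1 hiA
    refine ⟨boolPair (List.replicate i true) w, ?_, ?_⟩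
    · have hmono : p.eval (boolPair x (List.replicate i true)).length ≤
          p.eval (2 * x.length + 2 + q.eval x.length) := by
        apply TM2Iter.eval_mono; simp only [length_boolPair, List.length_replicate]; omega
      simp only [length_boolPair, List.length_replicate, eval_add, eval_mul, eval_ofNat, eval_X, eval_comp]
      omega
    · rw [hmem]
      simp only [fstP_boolPair, sndP_boolPair, List.length_replicate]
      exact ⟨hi, hw, hwR⟩
  · rintro ⟨y, -, hy⟩
    rw [hmem] at hy
    exact ⟨(fstP y).length, hy.1, (hp _).2 ⟨sndP y, hy.2.1, hy.2.2⟩⟩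

/-! ### `∀ i < q(|x|)` over `NP` -/

/-- The "index out of range" escape of the `ballLang` verifier: `⟨⟨x, Y⟩, u⟩ ↦ ⟨x, u⟩`, to be
tested in `(LenLt q)ᶜ` (`q(|x|) ≤ |u|`). [folklore] -/
noncomputable def ballI : List Bool → List Bool :=
  pairFn (fstP ∘ fstP) sndP

/-- `ballI ∈ FP`. [folklore] -/
theorem ballI_mem_FP : ballI ∈ FP :=
  pairFn_mem_FP (comp_mem_FP fstP_mem_FP fstP_mem_FP) sndP_mem_FP

/-- Value of `ballI`. [folklore] -/
@[simp] theorem ballI_boolPair (x Y u : List Bool) :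
    ballI (boolPair (boolPair x Y) u) = boolPair x u := by
  simp [ballI]

/-- The certificate reader of the `ballLang` verifier:
`⟨⟨x, Y⟩, u⟩ ↦ ⟨⟨x, 1^{|u|}⟩, elemFn ⟨u, Y⟩⟩` (the `|u|`-th certificate of the list `Y`). [folklore] -/
noncomputable def ballG : List Bool → List Bool :=
  pairFn (pairFn (fstP ∘ fstP) (onesFn ∘ sndP)) (elemFn ∘ pairFn sndP (sndP ∘ fstP))

/-- `ballG ∈ FP`. [folklore] -/
theorem ballG_mem_FP : ballG ∈ FP :=
  pairFn_mem_FP (pairFn_mem_FP (comp_mem_FP fstP_mem_FP fstP_mem_FP) (comp_mem_FP onesFn_mem_FP sndP_mem_FP))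
    (comp_mem_FP elemFn_mem_FP (pairFn_mem_FP sndP_mem_FP (comp_mem_FP sndP_mem_FP fstP_mem_FP)))

/-- Value of `ballG`. [folklore] -/
@[simp] theorem ballG_boolPair (x Y u : List Bool) :
    ballG (boolPair (boolPair x Y) u) =
      boolPair (boolPair x (List.replicate u.length true)) (elemOf Y u.length) := by
  simp [ballG, elemFn_boolPair]

/-- The matrix of the `ballLang` verifier: index out of range, or the `|u|`-th certificate is valid.
[folklore] -/
noncomputable def ballB (R : Language Bool) (p q : Polynomial ℕ) : Language Bool :=
  (ballI ⁻¹' LenLt q)ᶜ ⊔ ballG ⁻¹' (LenLe p ⊓ R)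

/-- `ballB R p q ∈ P` for `R ∈ P`. [folklore] -/
theorem ballB_mem_P {R : Language Bool} (hR : R ∈ Classes.P) (p q : Polynomial ℕ) : ballB R p q ∈ Classes.P :=
  union_mem_P (compl_mem_P_iff.2 (preimage_mem_P (LenLt_mem_P q) ballI_mem_FP))
    (preimage_mem_P (inter_mem_P (LenLe_mem_P p) hR) ballG_mem_FP)

/-- Membership in the matrix `ballB`. [folklore] -/
theorem mem_ballB_iff (R : Language Bool) (p q : Polynomial ℕ) (x Y u : List Bool) :
    boolPair (boolPair x Y) u ∈ ballB R p q ↔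
      q.eval x.length ≤ u.length ∨
        ((elemOf Y u.length).length ≤ p.eval (boolPair x (List.replicate u.length true)).length ∧
          boolPair (boolPair x (List.replicate u.length true)) (elemOf Y u.length) ∈ R) := by
  change (¬ ballI (boolPair (boolPair x Y) u) ∈ LenLt q ∨
    (ballG (boolPair (boolPair x Y) u) ∈ LenLe p ∧ ballG (boolPair (boolPair x Y) u) ∈ R)) ↔ _
  rw [ballI_boolPair, ballG_boolPair, boolPair_mem_LenLt, boolPair_mem_LenLe, not_lt]

/-- **`NP` is closed under polynomially bounded `∀`**: `ballLang q A ∈ NP` for `A ∈ NP` (guess the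
list of all `q(|x|)` certificates, verify them in a polynomially bounded loop).
[Arora–Barak 2009, §2.1, Exercise 2.10 and §1.3; Papadimitriou 1994, §10.1] [cite: AroraBarakCC2009, Def. 2.1] -/
theorem ballLang_mem_NP (q : Polynomial ℕ) {A : Language Bool} (hA : A ∈ Nondeterministic.NP) : ballLang q A ∈ Nondeterministic.NP := by
  classical
  obtain ⟨R, hR, p, hp⟩ := hA
  refine ⟨ballLang q (ballB R p q), ballLang_mem_P q (ballB_mem_P hR p q),
    q * (2 * p.comp (2 * X + 2 + q) + 2), fun x => ?_⟩
  rw [mem_ballLang]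
  constructor
  · intro hx
    -- choose the certificates
    have hW : ∀ i, ∃ w : List Bool, i < q.eval x.length →
        w.length ≤ p.eval (boolPair x (List.replicate i true)).length ∧
          boolPair (boolPair x (List.replicate i true)) w ∈ R := fun i => by
      by_cases hi : i < q.eval x.length
      · obtain ⟨w, hw, hwR⟩ := (hp _).1 (hx i hi)
        exact ⟨w, fun _ => ⟨hw, hwR⟩⟩
      · exact ⟨[], fun h => absurd h hi⟩
    choose W hW using hW
    set cs : List (List Bool) := List.ofFn fun i : Fin (q.eval x.length) => W i with hcs
    have hcslen : cs.length = q.eval x.length := by simp [hcs]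
    have hcsget : ∀ i, i < q.eval x.length → cs.getD i [] = W i := fun i hi => by
      rw [List.getD_eq_getElem _ _ (by rw [hcslen]; exact hi)]
      simp [hcs]
    have hbound : ∀ i, i < q.eval x.length → (W i).length ≤ p.eval (2 * x.length + 2 + q.eval x.length) :=
      fun i hi => ((hW i hi).1).trans (by
        apply TM2Iter.eval_mono; simp only [length_boolPair, List.length_replicate]; omega)
    refine ⟨body cs, ?_, ?_⟩
    · have hb := length_body_le (cs := cs) (b := p.eval (2 * x.length + 2 + q.eval x.length))
        (fun c hc => by
          rw [hcs, List.mem_ofFn] at hc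
          obtain ⟨i, rfl⟩ := hc
          exact hbound i i.2)
      rw [hcslen] at hb
      simpa only [eval_mul, eval_add, eval_ofNat, eval_comp, eval_X] using hb
    · rw [mem_ballLang]
      intro i _
      rw [mem_ballB_iff]
      by_cases hi : q.eval x.length ≤ i
      · exact Or.inl (by simpa using hi)
      · right
        have hi' : i < q.eval x.length := lt_of_not_ge hi
        simp only [List.length_replicate]
        rw [elemOf_body, hcsget i hi']
        exact hW i hi'
  · rintro ⟨Y, -, hY⟩ i hi
    rw [mem_ballLang] at hY
    have hiv : i < q.eval (boolPair x Y).length :=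
      lt_of_lt_of_le hi (TM2Iter.eval_mono q (by simp only [length_boolPair]; omega))
    have h := (mem_ballB_iff R p q x Y _).1 (hY i hiv)
    simp only [List.length_replicate] at h
    rcases h with h | ⟨hlen, hmem⟩
    · omega
    · exact (hp _).2 ⟨_, hlen, hmem⟩

/-! ### The dual statements -/

/-- `(ballLang q A)ᶜ = bexLang q Aᶜ`. [folklore] -/
theorem compl_ballLang (q : Polynomial ℕ) (A : Language Bool) : (ballLang q A)ᶜ = bexLang q Aᶜ := by
  ext x
  change (¬ ∀ i < q.eval x.length, boolPair x (List.replicate i true) ∈ A) ↔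
    ∃ i < q.eval x.length, ¬ boolPair x (List.replicate i true) ∈ A
  push Not
  exact Iff.rfl

/-- `(bexLang q A)ᶜ = ballLang q Aᶜ`. [folklore] -/
theorem compl_bexLang (q : Polynomial ℕ) (A : Language Bool) : (bexLang q A)ᶜ = ballLang q Aᶜ := by
  ext x
  change (¬ ∃ i < q.eval x.length, boolPair x (List.replicate i true) ∈ A) ↔
    ∀ i < q.eval x.length, ¬ boolPair x (List.replicate i true) ∈ A
  push Not
  exact Iff.rfl

/-- **`coNP` is closed under polynomially bounded `∀`.** [Arora–Barak 2009, §2.6.1 and Exercise 2.10] [cite: AroraBarakCC2009, Def. 2.1] -/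
theorem ballLang_mem_coNP (q : Polynomial ℕ) {A : Language Bool} (hA : A ∈ coNP) : ballLang q A ∈ coNP := by
  change (ballLang q A)ᶜ ∈ Nondeterministic.NP
  rw [compl_ballLang]
  exact bexLang_mem_NP q hA

/-- **`coNP` is closed under polynomially bounded `∃`.** [Arora–Barak 2009, §2.6.1 and Exercise 2.10] [cite: AroraBarakCC2009, Def. 2.1] -/
theorem bexLang_mem_coNP (q : Polynomial ℕ) {A : Language Bool} (hA : A ∈ coNP) : bexLang q A ∈ coNP := by
  change (bexLang q A)ᶜ ∈ Nondeterministic.NP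
  rw [compl_bexLang]
  exact ballLang_mem_NP q hA

end NPBounded

end Literature.Computability.Complexity
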